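/-
Copyright: b2b-lace packet (tail-bound analyst, gen 2). Rule WSUP-PRINT (KSUP.md §8): the
sup over `x ≠ 0` of `K_{n,l}(x)` is reduced to finitely many representatives `2e₁, 1_S`.
-/
import Literature.Probability.FitznerVanDerHofstad2017.SrwIntegralOrbit
import Literature.Probability.FitznerVanDerHofstad2017.SrwIntegralDomination

/-!
# Sup-over-`x` reduction for `K_{n,l}(x)` (rule WSUP-PRINT)

Combining (W1) the Cauchy–Schwarz split `K_{n,m+j}(x) ≤ √I_{n,2m}(0) · √W_{n,j}(x)`
(`srwK_le_sqrt_srwI_mul_srwW`), (W2) the orbit formula `W_{n,j}(x) = |W_d|⁻¹ Σ_σ I_{n,2j}(x - σx)`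
(`srwW_eq_orbit_sum`) and (W4) termwise domination (`orbitAvg_le_indicator`,
`orbitAvg_le_two_axis`), under the HYPOTHESIS that `z ↦ I_{n,2j}(z)` is non-increasing under
coordinatewise domination of absolute values (the hypothesis `hmono`; [HS92b, Lemma B.3] prints it
for `I_{n,0}` only, [FvdH17-NoBLE] Lemma 5.1 / Fitzner's thesis p. 101 assert it for all `l` without a
printed proof — REFEREE v12 R46; the parity-class weakening that suffices is the kernel theorem
`parityMonotone_srwI` of `SrwIntegralParityMonotone`), we get: for `x` with support `S`, `|S| ≥ 1`, `x_μ ≥ 1` on `S`: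
`W_{n,j}(x) ≤ W_{n,j}(1_S)` and hence `K_{n,m+j}(x) ≤ √I_{n,2m}(0) √W_{n,j}(1_S)`; and for
`x = a e_i`, `|a| ≥ 2`: `K_{n,m+j}(a e_i) ≤ √I_{n,2m}(0) √W_{n,j}(2 e_i)`.
-/

namespace Literature.Probability.FitznerVanDerHofstad2017

open MeasureTheory Finset Real

variable {d : ℕ}

/-- Coordinatewise monotonicity of a lattice function under domination of absolute values
(the form in which the B.3-shaped hypothesis + `W_d`-invariance is consumed; [HS92b] B.3 itself is
printed for `I_{n,0}` only — REFEREE v12 R46).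
[cite: FitznerVanDerHofstad2016NoBLE, Lemma 5.1 p. 1093] -/
def AbsMonotone (f : (Fin d → ℤ) → ℝ) : Prop :=
  ∀ z z' : Fin d → ℤ, (∀ μ, |z' μ| ≤ |z μ|) → f z ≤ f z'

/-- Bridge between the pair-sum of `SrwIntegralOrbit` and the iterated orbit average of
`SrwIntegralDomination`: `W_{n,j}(x) = orbitAvg I_{n,2j} x`.
[cite: FitznerVanDerHofstad2016NoBLE, (5.16) p. 1092] -/
theorem srwW_eq_orbitAvg {n : ℕ} (hd : 2 * n + 1 ≤ d) (j : ℕ) (x : Fin d → ℤ) :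
    srwW d n j x = orbitAvg (srwI d n (2 * j)) x := by
  rw [srwW_eq_orbit_sum hd, orbitAvg, Fintype.sum_prod_type]
  rfl

/-- SUPPORT REDUCTION for `W`: `W_{n,j}(x) ≤ W_{n,j}(1_S)` for `x ≥ 1` on its support `S`.
(b2b-lace KSUP.md §8.) [folklore] -/
theorem srwW_le_srwW_indicator {n : ℕ} (hd : 2 * n + 1 ≤ d) (j : ℕ)
    (hmono : AbsMonotone (srwI d n (2 * j))) (S : Finset (Fin d)) (x : Fin d → ℤ)
    (hS : ∀ μ ∈ S, 1 ≤ x μ) (hS' : ∀ μ, μ ∉ S → x μ = 0) :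
    srwW d n j x ≤ srwW d n j (indicatorVec S) := by
  rw [srwW_eq_orbitAvg hd, srwW_eq_orbitAvg hd]
  exact orbitAvg_le_indicator _ hmono S x hS hS'

/-- AXIS REDUCTION for `W`: `W_{n,j}(a e_i) ≤ W_{n,j}(2 e_i)` for `|a| ≥ 2`.
(b2b-lace KSUP.md §8.) [folklore] -/
theorem srwW_le_srwW_axis_two {n : ℕ} (hd : 2 * n + 1 ≤ d) (j : ℕ)
    (hmono : AbsMonotone (srwI d n (2 * j))) (i : Fin d) (a : ℤ) (ha : 2 ≤ |a|) :
    srwW d n j (axisVec i a) ≤ srwW d n j (axisVec i 2) := by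
  rw [srwW_eq_orbitAvg hd, srwW_eq_orbitAvg hd]
  exact orbitAvg_le_two_axis _ hmono i a ha

/-- **WSUP-PRINT, support case**: `K_{n,m+j}(x) ≤ √I_{n,2m}(0) · √W_{n,j}(1_S)` for every `x` that
is `≥ 1` exactly on `S` (so the sup over all such `x` is attained at the representative `1_S`).
(b2b-lace KSUP.md §8.) [folklore] -/
theorem srwK_le_sqrt_srwW_indicator {n : ℕ} (hd : 2 * n + 1 ≤ d) (m j : ℕ)
    (hmono : AbsMonotone (srwI d n (2 * j))) (S : Finset (Fin d)) (x : Fin d → ℤ)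
    (hS : ∀ μ ∈ S, 1 ≤ x μ) (hS' : ∀ μ, μ ∉ S → x μ = 0) :
    srwK d n (m + j) x ≤
      Real.sqrt (srwI d n (2 * m) 0) * Real.sqrt (srwW d n j (indicatorVec S)) :=
  srwK_le_sqrt_of_srwW_le hd m j x (srwW_le_srwW_indicator hd j hmono S x hS hS')

/-- **WSUP-PRINT, axis case**: `K_{n,m+j}(a e_i) ≤ √I_{n,2m}(0) · √W_{n,j}(2 e_i)` for `|a| ≥ 2`.
(b2b-lace KSUP.md §8.) [folklore] -/
theorem srwK_le_sqrt_srwW_axis_two {n : ℕ} (hd : 2 * n + 1 ≤ d) (m j : ℕ)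
    (hmono : AbsMonotone (srwI d n (2 * j))) (i : Fin d) (a : ℤ) (ha : 2 ≤ |a|) :
    srwK d n (m + j) (axisVec i a) ≤
      Real.sqrt (srwI d n (2 * m) 0) * Real.sqrt (srwW d n j (axisVec i 2)) :=
  srwK_le_sqrt_of_srwW_le hd m j _ (srwW_le_srwW_axis_two hd j hmono i a ha)

end Literature.Probability.FitznerVanDerHofstad2017
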